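import Mathlib

/-!
# AtomicCalibrationR (stmt-QuantumFields-28169), E2 `stub_offDiagonalWhitney` — smooth pairwise cut-offs and their telescoping
# (construction (T) of the E2 helper note `E2-helpers.md`, evidence #19 on 28169; prover w4 g22, free hands)

The normalisation-free way to localise an off-diagonal test function in dyadic bands around the coincidence locus:
with a smooth step `stepψ` (`= 0` on `(−∞,1]`, `= 1` on `[4,∞)`, values in `[0,1]`) put
`pairCut n k z := ∏_{l ≠ l'} stepψ (4^k ‖z_l − z_{l'}‖²)` on `Fin n → ℝ⁴`.  Then

* `contDiff_pairCut`, `pairCut_nonneg`, `pairCut_le_one`;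
* `pairCut_eq_one_of_far` — all pairs `≥ 2·2^{−k}` apart ⇒ `pairCut = 1`; `pairCut_eq_zero_of_near` — some pair `≤ 2^{−k}` ⇒ `= 0`
  (so `pairCut (k) − pairCut (k−1)` lives where `2^{−k} < distFat < 2^{2−k}`, via `distFat_le` / `exists_pair_distFat_eq` of
  `AtomicCalibrationRDistFat`);
* telescoping: `pairCut_eq_zero_of_mem_locus` (on the locus every cut-off vanishes), `eventually_pairCut_eq_one` (off the locus they
  are eventually `1`), `hasSum_pairCut_sub` (`HasSum (k ↦ pairCut (k+1) z − pairCut k z) (1 − pairCut 0 z)` off the locus) — the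
  pointwise identity behind clause (vii) of `WhitneyPkg`, to be multiplied by the exact grid partition `hasSum_gridBump_one`.

Mathlib only; no stub/crux/rung/summit is closed; nothing here touches Yang–Mills; the YM mass gap is NOT proved. [folklore]
-/

set_option autoImplicit false

noncomputable section

open scoped BigOperators ContDiff
open Set Filter

namespace Summit.QuantumFields.YangMills.Cruxes.AtomicCalibrationR.PairCutoff

/-! ## The smooth step -/

/-- A smooth step: `0` on `(−∞, 1]`, `1` on `[4, ∞)`, values in `[0, 1]`. -/
def stepψ (x : ℝ) : ℝ := Real.smoothTransition ((x - 1) / 3)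

/-- The step is `C^∞`. -/
theorem contDiff_stepψ : ContDiff ℝ ∞ stepψ :=
  Real.smoothTransition.contDiff.comp ((contDiff_id.sub contDiff_const).div_const 3)

/-- Below `1` the step vanishes. -/
theorem stepψ_eq_zero {x : ℝ} (hx : x ≤ 1) : stepψ x = 0 :=
  Real.smoothTransition.zero_of_nonpos (by rw [div_nonpos_iff]; right; constructor <;> linarith)

/-- Above `4` the step is `1`. -/
theorem stepψ_eq_one {x : ℝ} (hx : 4 ≤ x) : stepψ x = 1 :=
  Real.smoothTransition.one_of_one_le (by rw [le_div_iff₀ (by norm_num : (0 : ℝ) < 3)]; linarith)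

/-- The step is non-negative. -/
theorem stepψ_nonneg (x : ℝ) : 0 ≤ stepψ x := Real.smoothTransition.nonneg _

/-- The step is at most `1`. -/
theorem stepψ_le_one (x : ℝ) : stepψ x ≤ 1 := Real.smoothTransition.le_one _

/-! ## The pairwise cut-off at dyadic scale `2^{-k}` -/

/-- The ordered pairs of distinct slots. -/
def pairs (n : ℕ) : Finset (Fin n × Fin n) := (Finset.univ : Finset (Fin n × Fin n)).filter fun p => p.1 ≠ p.2

/-- `pairCut n k z = ∏_{l ≠ l'} ψ(4^k ‖z_l − z_{l'}‖²)`. -/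
def pairCut (n k : ℕ) (z : Fin n → EuclideanSpace ℝ (Fin 4)) : ℝ :=
  ∏ p ∈ pairs n, stepψ ((4 : ℝ) ^ k * ‖z p.1 - z p.2‖ ^ 2)

/-- The cut-off is `C^∞`. -/
theorem contDiff_pairCut (n k : ℕ) : ContDiff ℝ ∞ (pairCut n k) := by
  unfold pairCut
  refine contDiff_prod fun p _ => contDiff_stepψ.comp ?_
  have h1 : ContDiff ℝ ∞ (fun z : Fin n → EuclideanSpace ℝ (Fin 4) => z p.1 - z p.2) :=
    (contDiff_apply ℝ (EuclideanSpace ℝ (Fin 4)) p.1).sub (contDiff_apply ℝ (EuclideanSpace ℝ (Fin 4)) p.2)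
  exact contDiff_const.mul (h1.norm_sq ℝ)

/-- `0 ≤ pairCut`. -/
theorem pairCut_nonneg (n k : ℕ) (z : Fin n → EuclideanSpace ℝ (Fin 4)) : 0 ≤ pairCut n k z :=
  Finset.prod_nonneg fun _ _ => stepψ_nonneg _

/-- `pairCut ≤ 1`. -/
theorem pairCut_le_one (n k : ℕ) (z : Fin n → EuclideanSpace ℝ (Fin 4)) : pairCut n k z ≤ 1 :=
  Finset.prod_le_one (fun _ _ => stepψ_nonneg _) fun _ _ => stepψ_le_one _

/-- **Far ⇒ 1.**  If all pairs of distinct slots are at least `2·2^{−k}` apart, `pairCut n k z = 1`. -/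
theorem pairCut_eq_one_of_far {n k : ℕ} {z : Fin n → EuclideanSpace ℝ (Fin 4)}
    (h : ∀ l l' : Fin n, l ≠ l' → 2 * (2 : ℝ)⁻¹ ^ k ≤ ‖z l - z l'‖) : pairCut n k z = 1 := by
  refine Finset.prod_eq_one fun p hp => stepψ_eq_one ?_
  have hll' : p.1 ≠ p.2 := (Finset.mem_filter.1 hp).2
  have hd := h p.1 p.2 hll'
  have h0 : 0 ≤ 2 * (2 : ℝ)⁻¹ ^ k := by positivity
  have hsq : (2 * (2 : ℝ)⁻¹ ^ k) ^ 2 ≤ ‖z p.1 - z p.2‖ ^ 2 := pow_le_pow_left₀ h0 hd 2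
  have hkey : (4 : ℝ) ^ k * (2 * (2 : ℝ)⁻¹ ^ k) ^ 2 = 4 := by
    rw [mul_pow, ← pow_mul, show (4 : ℝ) = 2 ^ 2 by norm_num, ← pow_mul, inv_pow, mul_comm 2 k]
    field_simp
  calc (4 : ℝ) = (4 : ℝ) ^ k * (2 * (2 : ℝ)⁻¹ ^ k) ^ 2 := hkey.symm
    _ ≤ (4 : ℝ) ^ k * ‖z p.1 - z p.2‖ ^ 2 := mul_le_mul_of_nonneg_left hsq (by positivity)

/-- **Near ⇒ 0.**  If some pair of distinct slots is within `2^{−k}`, `pairCut n k z = 0`. -/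
theorem pairCut_eq_zero_of_near {n k : ℕ} {z : Fin n → EuclideanSpace ℝ (Fin 4)} {l l' : Fin n} (hll' : l ≠ l')
    (h : ‖z l - z l'‖ ≤ (2 : ℝ)⁻¹ ^ k) : pairCut n k z = 0 := by
  have hp : (l, l') ∈ pairs n := Finset.mem_filter.2 ⟨Finset.mem_univ _, hll'⟩
  refine Finset.prod_eq_zero hp (stepψ_eq_zero ?_)
  have hsq : ‖z l - z l'‖ ^ 2 ≤ ((2 : ℝ)⁻¹ ^ k) ^ 2 := pow_le_pow_left₀ (norm_nonneg _) h 2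
  have hkey : (4 : ℝ) ^ k * ((2 : ℝ)⁻¹ ^ k) ^ 2 = 1 := by
    rw [← pow_mul, show (4 : ℝ) = 2 ^ 2 by norm_num, ← pow_mul, inv_pow, mul_comm 2 k]
    field_simp
  calc (4 : ℝ) ^ k * ‖z l - z l'‖ ^ 2 ≤ (4 : ℝ) ^ k * ((2 : ℝ)⁻¹ ^ k) ^ 2 :=
        mul_le_mul_of_nonneg_left hsq (by positivity)
    _ = 1 := hkey

/-! ## Telescoping -/

/-- On the coincidence locus every cut-off vanishes. -/
theorem pairCut_eq_zero_of_mem_locus {n : ℕ} {z : Fin n → EuclideanSpace ℝ (Fin 4)} {l l' : Fin n} (hll' : l ≠ l')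
    (h : z l = z l') (k : ℕ) : pairCut n k z = 0 :=
  pairCut_eq_zero_of_near hll' (by rw [h, sub_self, norm_zero]; positivity)

/-- Off the coincidence locus the cut-offs are eventually `1`. -/
theorem eventually_pairCut_eq_one {n : ℕ} {z : Fin n → EuclideanSpace ℝ (Fin 4)}
    (h : ∀ l l' : Fin n, l ≠ l' → z l ≠ z l') : ∀ᶠ k in atTop, pairCut n k z = 1 := by
  -- for each pair, `2·2^{-k} ≤ ‖z_l − z_{l'}‖` eventually
  have hlim : Tendsto (fun k : ℕ => 2 * (2 : ℝ)⁻¹ ^ k) atTop (nhds 0) := by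
    have := tendsto_pow_atTop_nhds_zero_of_lt_one (by norm_num : (0 : ℝ) ≤ 2⁻¹) (by norm_num : (2 : ℝ)⁻¹ < 1)
    simpa using this.const_mul 2
  have hpair : ∀ p ∈ pairs n, ∀ᶠ k in atTop, 2 * (2 : ℝ)⁻¹ ^ k ≤ ‖z p.1 - z p.2‖ := by
    intro p hp
    have hpos : 0 < ‖z p.1 - z p.2‖ := norm_pos_iff.2 (sub_ne_zero.2 (h p.1 p.2 (Finset.mem_filter.1 hp).2))
    exact (hlim.eventually (gt_mem_nhds hpos)).mono fun k hk => hk.le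
  have hall := (eventually_all_finset (pairs n)).2 hpair
  refine hall.mono fun k hk => pairCut_eq_one_of_far fun l l' hll' => ?_
  exact hk (l, l') (Finset.mem_filter.2 ⟨Finset.mem_univ _, hll'⟩)

/-- Partial sums telescope. -/
theorem sum_range_pairCut_sub (n K : ℕ) (z : Fin n → EuclideanSpace ℝ (Fin 4)) :
    ∑ k ∈ Finset.range K, (pairCut n (k + 1) z - pairCut n k z) = pairCut n K z - pairCut n 0 z :=
  Finset.sum_range_sub (fun k => pairCut n k z) K

/-- **Telescoping off the locus**: `Σ_k (pairCut (k+1) z − pairCut k z) = 1 − pairCut 0 z`. -/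
theorem hasSum_pairCut_sub {n : ℕ} {z : Fin n → EuclideanSpace ℝ (Fin 4)}
    (h : ∀ l l' : Fin n, l ≠ l' → z l ≠ z l') :
    HasSum (fun k : ℕ => pairCut n (k + 1) z - pairCut n k z) (1 - pairCut n 0 z) := by
  obtain ⟨k₀, hk₀⟩ := eventually_atTop.1 (eventually_pairCut_eq_one h)
  have hzero : ∀ k ∉ Finset.range k₀, pairCut n (k + 1) z - pairCut n k z = 0 := by
    intro k hk
    rw [Finset.mem_range, not_lt] at hk
    rw [hk₀ k hk, hk₀ (k + 1) (hk.trans (Nat.le_succ k)), sub_self]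
  have hfin : HasSum (fun k : ℕ => pairCut n (k + 1) z - pairCut n k z)
      (∑ k ∈ Finset.range k₀, (pairCut n (k + 1) z - pairCut n k z)) := hasSum_sum_of_ne_finset_zero hzero
  rwa [sum_range_pairCut_sub, hk₀ k₀ le_rfl] at hfin

/-- **Telescoping on the locus**: every term vanishes, so the series sums to `0 = 1 − 1·…`; stated as `HasSum … 0`. -/
theorem hasSum_pairCut_sub_of_mem_locus {n : ℕ} {z : Fin n → EuclideanSpace ℝ (Fin 4)} {l l' : Fin n} (hll' : l ≠ l')
    (h : z l = z l') : HasSum (fun k : ℕ => pairCut n (k + 1) z - pairCut n k z) 0 := by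
  have : (fun k : ℕ => pairCut n (k + 1) z - pairCut n k z) = fun _ => 0 := by
    funext k; rw [pairCut_eq_zero_of_mem_locus hll' h, pairCut_eq_zero_of_mem_locus hll' h, sub_self]
  rw [this]; exact hasSum_zero

end Summit.QuantumFields.YangMills.Cruxes.AtomicCalibrationR.PairCutoff

end
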